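import Summits.QuantumFields.YangMills.Theorems.BalabanUVNodesN15TwoSpacingGluingNeumannKnitNode
import Summits.QuantumFields.YangMills.Theorems.BalabanUVNodesN15TwoSpacingGluingNeumannKnitRightRemainder
import HarnessLib

/-!
# THE GLUING STEP AT TWO LATTICE SPACINGS, LIV: `NE2PlusOperator` BY NAME FOR THE COVER's GLUED PAIR ON THE DOUBLED TORUS, `(gf i).M := L^m` LIVE, MODULO ONE ROW — THE TWO-GRID
# DEFECT OF THE ADJOINT REMAINDER (dag-n15-c g13, FILE 96; N15 = NE2, s1 «background-layer OPERATOR ingredient»)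

Cell `pub-ymgap`, seat `pub-ymgap-dag-n15-c` (R134 (a); HUMAN RULING D-0062), generation 13.  `bears_on: R4∕N15 · K3⁸ SpineGivenEndpointR13SepCoPHV (stmt-QuantumFields-27366)`
(KEY MAP v2).  Filed `--supports stmt-QuantumFields-27366 --as helper` — COUNT-NEUTRAL.  Theorems only (0 `def`, 0 `sorry`).  Imports BY NAME FILE 93 `…NeumannKnitNode` (`KnitIdx`,
`knitInstance`, `knitFamily`, `ne2PlusOperator_knit_of_rightRows`) and FILE 95 `…NeumannKnitRightRemainder` (`hasMaj_remainderL_knit_pair`); nothing in the tree is modified.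

WHAT.  ★★★ **`ne2PlusOperator_knit_of_rightDefect`** — `d ≥ 1`, odd `L ≥ 3`, `a > 0`, any `c₃₅, θc, θ`: IF the two-grid defect of the cover's adjoint remainder obeys
`𝔇(R̃′, R̃) ≤ r_L(L^k)^{−γ_L}e^{−δ_Ld}` (`k ≥ 1`, `4 ≤ L^k`, window `M₅ ≤ L^m`) THEN `NE2PlusOperator c₃₅ (knitInstance hL θc θ) (knitFamily hL a θc θ)` — FILE 93's
`ne2PlusOperator_knit_of_rightRows` with its first two displayed rows (`R̃ ≤ (κ_L∕L^m)e^{−δ_Ld}` at both spacings) DISCHARGED by FILE 95 `hasMaj_remainderL_knit_pair` (one rate by `min`, the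
defect's constant kept).  Of FILE 50's fourteen `GluedLetters` rows for the glued `U ≡ 1` family THIRTEEN are now tree theorems; the fourteenth (`𝔇(R̃′, R̃)`) is the one displayed
hypothesis.  ★ `ne2PlusOperator_knit_of_rightDefect_dim4` (`d + 1 = 4`).

HONEST FRAMING ∕ LIMITS.  CONDITIONAL on the displayed adjoint-remainder DEFECT row (its local part needs dag-n15-a's forward right-entry defect (c)⁺ — N-IIo `hasMaj_idef_rightGrad_of_torusDefect`,
hypothesis-free after INTENT N-IIp∕q∕r — and its nonlocal part a source-side two-grid letter of `aQ*Q − ∂Π∂*` behind the cube).  Glued `U ≡ 1` family: the entries do not depend on `U`, the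
(3.35) guard is consumed vacuously — NOT [B9]'s background-dependent pair; block-majorant bookkeeping over LANDED rows on the doubled-cube torus MODEL (cube = half torus: circular as an
estimate); nothing of [B6] (2.38)–(2.40) ∕ [B9] Thm 3.1, 3.14 asserted.  NE2⁺ NOT PRINTED for the physical family, NOT proved; N15 NOT discharged; counts of record UNMOVED (typed 28∕28 ·
discharged 5∕27); one finite 𝕋⁴ at fixed ε per index — NOT infinite volume, NOT OS on ℝ⁴, NOT a mass gap, NOT Clay; R4 closes `BalabanLadder.UV` only.  Restate-immune (no Theses import).
-/

noncomputable section

namespace Summit.QuantumFields.YangMills.BalabanUVNodes.N15.Gluing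

open Real
open Literature.MathematicalPhysics.QuantumFieldTheory.Balaban1983to89
open Literature.MathematicalPhysics.QuantumFieldTheory.Balaban1983to89.B5Prop11Plancherel (Tor fine)
open Literature.MathematicalPhysics.QuantumFieldTheory.Balaban1983to89.B11SectG (BlockNorm HasMaj)
open Literature.MathematicalPhysics.QuantumFieldTheory.Balaban1983to89.T4EtaRate (NE2PlusOperator)
open Literature.MathematicalPhysics.QuantumFieldTheory.Balaban1983to89.T4EtaRateDefect (idef)
open Literature.MathematicalPhysics.QuantumFieldTheory.Balaban1983to89.T4EtaRateCoeffDefect (pull)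
open Literature.MathematicalPhysics.QuantumFieldTheory.Balaban1983to89.B6UnitTorusCarrier (unitTorusGeo)
open Literature.MathematicalPhysics.QuantumFieldTheory.Balaban1983to89.B5SiteBridgeP12 (MP)
open Literature.MathematicalPhysics.QuantumFieldTheory.King1986.Torus (blockOf tdistT tdistT_nonneg)
open Summit.QuantumFields.YangMills.BalabanUVNodes.N15.VectorPiece (kingPrV)
open Summit.QuantumFields.YangMills.BalabanUVNodes.N15.TwoGrid (paramsOf deltaOp)

variable {d : ℕ} {L : ℕ} [NeZero L]

/-- ★★★ **NE2⁺, OPERATOR LAYER, BY NAME, FOR THE COVER's GLUED PAIR — `(gf i).M := L^m` LIVE — MODULO THE TWO-GRID DEFECT OF THE ADJOINT REMAINDER.**  `d ≥ 1`, odd `L ≥ 3`, `a > 0`, any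
`c₃₅, θc, θ`.  IF `𝔇(R̃′, R̃) ≤ r_L(L^k)^{−γ_L}e^{−δ_Ld}` whenever `k ≥ 1`, `4 ≤ L^k`, `M₅ ≤ L^m`, THEN `NE2PlusOperator c₃₅ (knitInstance hL θc θ) (knitFamily hL a θc θ)` — FILE 93 fed with FILE 95's
hypothesis-free rows `R̃ ≤ (κ∕L^m)e^{−δd}` at both spacings. [cite: Balaban1985BackgroundPropagators, Thm 3.1 p.397 (quantifier template «M ≥ M₁ … Mα₀ ≤ a₀»); Balaban1984PropagatorsII, Prop. 2.6
(2.135)–(2.136) p.247 (mechanism), (2.91)–(2.93) p.239; King1986, Prop. 3.9 (3.73) p.665 (rate factor)] -/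
theorem ne2PlusOperator_knit_of_rightDefect (hd1 : 1 ≤ d) (hL : Odd L ∧ 1 < L) {a : ℝ} (ha : 0 < a) (c35 θc θ : ℝ) {M₅ : ℝ}
    (hIRL : ∃ δL rL γL : ℝ, 0 < δL ∧ 0 ≤ rL ∧ 0 < γL ∧ ∀ (m kk r : ℕ) (_hk : 1 ≤ kk) (_hn4 : 4 ≤ L ^ kk) (_hM : M₅ ≤ (L : ℝ) ^ m),
      HasMaj (BlockNorm.ofBlocks (unitTorusGeo L kk (MP (paramsOf d L (m + 1) kk hL)))
          (fun b : Tor (fine (L ^ kk) (MP (paramsOf d L (m + 1) kk hL))) × Fin (d + 1) => blockOf (L ^ kk) (MP (paramsOf d L (m + 1) kk hL)) b.1))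
        (BlockNorm.ofBlocks (unitTorusGeo L kk (MP (paramsOf d L (m + 1) kk hL)))
          (fun x : Tor (fine (L ^ r * L ^ kk) (MP (paramsOf d L (m + 1) kk hL))) × Fin (d + 1) => blockOf (L ^ r * L ^ kk) (MP (paramsOf d L (m + 1) kk hL)) x.1))
        (idef (pull (kingPrV L kk r (MP (paramsOf d L (m + 1) kk hL)))) (pull (kingPrV L kk r (MP (paramsOf d L (m + 1) kk hL))))
          (remainderL (deltaOp (MP (paramsOf d L (m + 1) kk hL)) (L ^ r * L ^ kk) a) (knitH d L m kk (L ^ r * L ^ kk) hL) (knitG d L m kk (L ^ r * L ^ kk) hL a))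
          (remainderL (deltaOp (MP (paramsOf d L (m + 1) kk hL)) (L ^ kk) a) (knitH d L m kk (L ^ kk) hL) (knitG d L m kk (L ^ kk) hL a)))
        (fun y y' => rL * ((L : ℝ) ^ kk) ^ (-γL) * Real.exp (-(δL * tdistT (MP (paramsOf d L (m + 1) kk hL)) y y')))) :
    NE2PlusOperator c35 (knitInstance (d := d) hL θc θ) (knitFamily (d := d) hL a θc θ) := by
  obtain ⟨δL, rL, γL, hδL, hrL, hγL, HD⟩ := hIRL
  obtain ⟨δR, κ, hδR, hκ, HR⟩ := hasMaj_remainderL_knit_pair (d := d) hL ha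
  refine ne2PlusOperator_knit_of_rightRows (d := d) hd1 hL ha c35 θc θ (M₅ := M₅)
    ⟨min δL δR, κ, rL, γL, lt_min hδL hδR, hκ, hrL, hγL, fun m kk r hk hn4 hM => ?_⟩
  obtain ⟨h1, h2⟩ := HR m kk r hk
  have h3 := HD m kk r hk hn4 hM
  have hxm : (0 : ℝ) < (L : ℝ) ^ m := pow_pos (by exact_mod_cast (show 0 < L by have := hL.2; omega)) _
  have hκw : 0 ≤ κ / (L : ℝ) ^ m := div_nonneg hκ hxm.le
  have hρ : 0 ≤ rL * ((L : ℝ) ^ kk) ^ (-γL) := mul_nonneg hrL (Real.rpow_nonneg (pow_nonneg (Nat.cast_nonneg _) _) _)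
  have ht : ∀ y y' : Tor (MP (paramsOf d L (m + 1) kk hL)), 0 ≤ tdistT (MP (paramsOf d L (m + 1) kk hL)) y y' := fun y y' => tdistT_nonneg _ _ _
  have wR : ∀ y y' : Tor (MP (paramsOf d L (m + 1) kk hL)),
      κ / (L : ℝ) ^ m * Real.exp (-(δR * tdistT (MP (paramsOf d L (m + 1) kk hL)) y y')) ≤
        κ / (L : ℝ) ^ m * Real.exp (-(min δL δR * tdistT (MP (paramsOf d L (m + 1) kk hL)) y y')) := fun y y' =>
    mul_le_mul_of_nonneg_left (Real.exp_le_exp.mpr (neg_le_neg (mul_le_mul_of_nonneg_right (min_le_right _ _) (ht y y')))) hκw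
  have wD : ∀ y y' : Tor (MP (paramsOf d L (m + 1) kk hL)),
      rL * ((L : ℝ) ^ kk) ^ (-γL) * Real.exp (-(δL * tdistT (MP (paramsOf d L (m + 1) kk hL)) y y')) ≤
        rL * ((L : ℝ) ^ kk) ^ (-γL) * Real.exp (-(min δL δR * tdistT (MP (paramsOf d L (m + 1) kk hL)) y y')) := fun y y' =>
    mul_le_mul_of_nonneg_left (Real.exp_le_exp.mpr (neg_le_neg (mul_le_mul_of_nonneg_right (min_le_left _ _) (ht y y')))) hρ
  exact ⟨h1.mono wR, h2.mono wR, h3.mono wD⟩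

/-- The four-dimensional instance (`d + 1 = 4`). [cite: Balaban1985BackgroundPropagators, Thm 3.1 p.397 (quantifier template)] -/
theorem ne2PlusOperator_knit_of_rightDefect_dim4 (hL : Odd L ∧ 1 < L) {a : ℝ} (ha : 0 < a) (c35 θc θ : ℝ) {M₅ : ℝ}
    (hIRL : ∃ δL rL γL : ℝ, 0 < δL ∧ 0 ≤ rL ∧ 0 < γL ∧ ∀ (m kk r : ℕ) (_hk : 1 ≤ kk) (_hn4 : 4 ≤ L ^ kk) (_hM : M₅ ≤ (L : ℝ) ^ m),
      HasMaj (BlockNorm.ofBlocks (unitTorusGeo L kk (MP (paramsOf 3 L (m + 1) kk hL)))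
          (fun b : Tor (fine (L ^ kk) (MP (paramsOf 3 L (m + 1) kk hL))) × Fin (3 + 1) => blockOf (L ^ kk) (MP (paramsOf 3 L (m + 1) kk hL)) b.1))
        (BlockNorm.ofBlocks (unitTorusGeo L kk (MP (paramsOf 3 L (m + 1) kk hL)))
          (fun x : Tor (fine (L ^ r * L ^ kk) (MP (paramsOf 3 L (m + 1) kk hL))) × Fin (3 + 1) => blockOf (L ^ r * L ^ kk) (MP (paramsOf 3 L (m + 1) kk hL)) x.1))
        (idef (pull (kingPrV L kk r (MP (paramsOf 3 L (m + 1) kk hL)))) (pull (kingPrV L kk r (MP (paramsOf 3 L (m + 1) kk hL))))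
          (remainderL (deltaOp (MP (paramsOf 3 L (m + 1) kk hL)) (L ^ r * L ^ kk) a) (knitH 3 L m kk (L ^ r * L ^ kk) hL) (knitG 3 L m kk (L ^ r * L ^ kk) hL a))
          (remainderL (deltaOp (MP (paramsOf 3 L (m + 1) kk hL)) (L ^ kk) a) (knitH 3 L m kk (L ^ kk) hL) (knitG 3 L m kk (L ^ kk) hL a)))
        (fun y y' => rL * ((L : ℝ) ^ kk) ^ (-γL) * Real.exp (-(δL * tdistT (MP (paramsOf 3 L (m + 1) kk hL)) y y')))) :
    NE2PlusOperator c35 (knitInstance (d := 3) hL θc θ) (knitFamily (d := 3) hL a θc θ) :=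
  ne2PlusOperator_knit_of_rightDefect (d := 3) (by norm_num) hL ha c35 θc θ hIRL

end Summit.QuantumFields.YangMills.BalabanUVNodes.N15.Gluing

end
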